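import Literature.NumberTheory.Rogawski1990.FinExplicitTransferFactorSplitPlace               -- ★ D-S2 p835818: `finHeckeValue_eq_prod_pair_of_split`, `galAdicCompletionMap_finGammaTwo_galInv`, `…_eval_finCharpolyTwo_galInv`
import Literature.NumberTheory.GaloisRepresentations.HeckeCharacterGaloisConjLocalComponent  -- ★ `HeckeCharacter.localComponent_galConj_apply` (`(μ ∘ σ)_w = μ_{σw} ∘ σ_w`)
import HarnessLib

/-!
# Rogawski's `τ_v` AT A SPLIT PLACE under the conjugate-self-duality guard: `τ_v(γ_H) = μ_w(det g_w)` on the `(G,H)`-regular locus (Rogawski (1990) §4.9 p. 55)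

Topic `NumberTheory/Rogawski1990`; namespace `Literature.NumberTheory.Rogawski1990`.  THEOREMS ONLY (no definition, no named fact, no instance, no notation,
no `sorry`; net debt 0).  Cell `pub/hodgecm-mathlib`, F0∕P3a, topic T6 (#88 side; brick «B6», LEAD F0P3a-plan (g8) T7-12 (B): on B5's critical path — the
split clause of N6 needs `τ_v` as a smooth character of `M_v ≅ GL₂ × GL₁` and this holds ONLY under the guard `μ|_{𝕀_{L⁺}} = ω`, i.e. `μᶜ = μ⁻¹`).  Over ★ D-S2
`FinExplicitTransferFactorSplitPlace` and ★ `HeckeCharacterGaloisConjLocalComponent`.  Mathlib-only footing; count-neutral for the books.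

THE MATHEMATICS (`v` split in `L∕L⁺`, `w ∣ v`, `w̄ = c⁻¹w`, `σ = σ_{c,w̄} : L_{w̄} ≃ L_w`).  The GUARD is conjugate self-duality of the Hecke character,
`μ ∘ c = μ⁻¹` (forced by `μ|_{𝕀_{L⁺}} = ω_{L∕L⁺}`); locally it reads `μ_{w̄}(z) = μ_w(σ z)⁻¹` (★ `localComponent_galConj_apply`), so the semilocal value
`μ_v(x) = μ_w(x_w)·μ_{w̄}(x_{w̄})` (★ `finHeckeValue_eq_prod_pair_of_split`) is `μ_w(x_w)·μ_w(σ x_{w̄})⁻¹`.  For `γ_H = (g, u) ∈ H_v` unitarity at `w` gives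
`σ(u_{w̄}) = u_w⁻¹` (★), `σ(χ_{w̄}) = χ_w (det g_w)⁻¹ u_w⁻²` (★), `σ(det g_{w̄}) = (det g_w)⁻¹` (§1), whence for `τ`'s argument `t = −χ_g(u)·det g⁻¹`:
`t_w = −χ_w (det g_w)⁻¹`, `σ(t_{w̄}) = −χ_w u_w⁻²` (§1) and, when `χ_w ≠ 0` (`(G,H)`-regular),
`τ_v(γ_H) = μ_v(u)·μ_v(t)⁻¹ = μ_w(u_w)μ_w(u_w⁻¹)⁻¹ · (μ_w(t_w) μ_w(σ t_{w̄})⁻¹)⁻¹ = μ_w(u_w² · (−χ_w u_w⁻²) · (−χ_w (det g_w)⁻¹)⁻¹) = μ_w(det g_w)` — print's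
«at a split place `τ` is the character `μ_w ∘ det` of `M`» (p. 55 bottom).  Consequently `τ_v` is a CLASS FUNCTION of `det g_w` on the `(G,H)`-regular locus and
`Δ‴_v = μ_w(det g_w) · D_{G∕H,v}` on matching pairs (★ `finExplicitDelta_eq_tau_mul_weyl_of_split`).

* §1 (no guard) `isUnit_det_fst_map_apply`, **`galAdicCompletionMap_det_galInv`** (`σ(det g_{w̄}) = (det g_w)⁻¹`), `finTauArg_apply`
  (`t_{w′} = −χ_{w′}(det g_{w′})⁻¹`), **`galAdicCompletionMap_finTauArg_galInv`** (`σ(t_{w̄}) = −χ_w u_w⁻²`).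
* §2 (guard `hdual : HeckeCharacter.galConj c μ = μ⁻¹`) **`localComponent_galInv_eq_inv_of_galConj_eq_inv`** (`μ_{w̄}(z) = μ_w(σz)⁻¹`),
  **`finHeckeValue_eq_mul_inv_of_split`** (`μ_v(x) = μ_w(x_w)·μ_w(σ x_{w̄})⁻¹`).
* §3 **`finTau_eq_localComponent_det_of_split`** (`τ_v(γ_H) = μ_w(det g_w)`), **`finTau_eq_finTau_of_det_eq_of_split`** (class-function form),
  **`finExplicitDelta_eq_localComponent_det_mul_weyl_of_split`**.  Local constancy of `τ_v` in `γ_H` is ★ G2 `finTau_eventually_eq` (not restated).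

HONEST LABEL: HC_CM is proved only modulo the printed citations (named inputs remaining 2) until rung 0 closes; this file proves none of them.

## References
* [Rogawski1990] J. D. Rogawski, *Automorphic Representations of Unitary Groups in Three Variables*, Ann. of Math. Stud. 123 (1990): §4.9 p. 55 (bottom: `τ` at a split
  place), Lemma 4.13.1 p. 64, §14.6 p. 242.
* [TateThesis1967] J. Tate, *Fourier analysis in number fields and Hecke's zeta-functions*, §4.3 (local components).
* [CasselsFrohlichANT1967] Cassels–Fröhlich, *Algebraic Number Theory*, Ch. VII §1.1 (Galois action on local idèles).
-/

set_option autoImplicit false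

noncomputable section

open NumberField IsDedekindDomain Matrix Polynomial
open scoped MatrixGroups

namespace Literature.NumberTheory.Rogawski1990

open Literature.NumberTheory.Automorphic
open Literature.NumberTheory.GaloisRepresentations

variable (L : Type) [Field L] [NumberField L] [IsCMField L] (v : HeightOneSpectrum (𝓞 ↥(maximalRealSubfield L)))
  (a : (UnitaryGroup.cmDatum L 2 (Matrix.of fun i j : Fin 2 => if i.val + j.val + 1 = 2 then (1 : L) else 0)).Local v ×
      (UnitaryGroup.cmDatum L 1 (Matrix.of fun i j : Fin 1 => if i.val + j.val + 1 = 1 then (1 : L) else 0)).Local v)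
  (w : UnitaryGroup.PlacesOver L v)

/-! ## §1 Transport identities at a split place (no guard) -/

/-- `det(g_{w′}) = (det g)_{w′}` (★ `RingHom.map_det` for the evaluation `E_v → L_{w′}`). [folklore] -/
private theorem det_map_apply_eq (w' : UnitaryGroup.PlacesOver L v) :
    ((a.1.val.val : Matrix (Fin 2) (Fin 2) (UnitaryGroup.LocalRing L v)).map (fun x => x w')).det =
      (a.1.val.val : Matrix (Fin 2) (Fin 2) (UnitaryGroup.LocalRing L v)).det w' := by
  have h := (RingHom.map_det (Pi.evalRingHom (fun w'' : UnitaryGroup.PlacesOver L v => w''.1.adicCompletion L) w')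
    (a.1.val.val : Matrix (Fin 2) (Fin 2) (UnitaryGroup.LocalRing L v))).symm
  exact h

/-- `det g_{w′}` is a unit of `L_{w′}` (`g ∈ U(Φ₂)(L⁺_v)` invertible). [cite: Rogawski1990, §4.9 p. 55] -/
theorem isUnit_det_fst_map_apply (w' : UnitaryGroup.PlacesOver L v) :
    IsUnit ((a.1.val.val : Matrix (Fin 2) (Fin 2) (UnitaryGroup.LocalRing L v)).map (fun x => x w')).det := by
  rw [det_map_apply_eq]
  exact (Pi.isUnit_iff.1 (Matrix.isUnits_det_units a.1.val)) w'

/-- **`σ(det g_{w̄}) = (det g_w)⁻¹`** at a split place — the determinant of the unitarity relation `σ(g_{w̄})ᵀ Φ₂ g_w = Φ₂`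
(★ `transpose_map_galInv_mul_form_mul_eq`). [cite: Rogawski1990, Lemma 4.13.1 p. 64; §4.9 p. 55] -/
theorem galAdicCompletionMap_det_galInv :
    galAdicCompletionMap (L := L) (IsCMField.complexConj L) (smul_inv_smul (IsCMField.complexConj L) w.1)
        (((a.1.val.val : Matrix (Fin 2) (Fin 2) (UnitaryGroup.LocalRing L v)).map
          (fun x => x (UnitaryGroup.PlacesOver.galInv (IsCMField.complexConj L) w))).det) =
      (((a.1.val.val : Matrix (Fin 2) (Fin 2) (UnitaryGroup.LocalRing L v)).map (fun x => x w)).det)⁻¹ := by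
  have hU := congrArg Matrix.det (transpose_map_galInv_mul_form_mul_eq L v a w)
  rw [Matrix.det_mul, Matrix.det_mul, Matrix.det_transpose] at hU
  have hΦ : (Matrix.of fun i j : Fin 2 => if i.val + j.val + 1 = 2 then (1 : w.1.adicCompletion L) else 0).det ≠ 0 := by
    rw [Matrix.det_fin_two]
    simp [Matrix.of_apply]
  have hσ : (((a.1.val.val : Matrix (Fin 2) (Fin 2) (UnitaryGroup.LocalRing L v)).map
          (fun x => x (UnitaryGroup.PlacesOver.galInv (IsCMField.complexConj L) w))).map
          (galAdicCompletionMap (L := L) (IsCMField.complexConj L) (smul_inv_smul (IsCMField.complexConj L) w.1))).det =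
      galAdicCompletionMap (L := L) (IsCMField.complexConj L) (smul_inv_smul (IsCMField.complexConj L) w.1)
        (((a.1.val.val : Matrix (Fin 2) (Fin 2) (UnitaryGroup.LocalRing L v)).map
          (fun x => x (UnitaryGroup.PlacesOver.galInv (IsCMField.complexConj L) w))).det) :=
    (RingHom.map_det _ _).symm
  rw [hσ] at hU
  -- `σ(det g_{w̄}) · det Φ₂ · det g_w = det Φ₂`
  refine eq_inv_of_mul_eq_one_left (mul_right_cancel₀ hΦ ?_)
  rw [one_mul, ← mul_right_comm]
  exact hU

/-- **`t_{w′} = −χ_{w′}·(det g_{w′})⁻¹`** for `τ`'s argument `t = −χ_g(u)·det g⁻¹` (★ `finTauArg`), at every `w′ ∣ v`. [cite: Rogawski1990, §4.9 p. 55] -/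
theorem finTauArg_apply (w' : UnitaryGroup.PlacesOver L v) :
    finTauArg L v a w' =
      -(((finCharpolyTwo L v a).eval (finGammaTwo L v a)) w') *
        (((a.1.val.val : Matrix (Fin 2) (Fin 2) (UnitaryGroup.LocalRing L v)).map (fun x => x w')).det)⁻¹ := by
  have hdet : ((a.1.val⁻¹).val : Matrix (Fin 2) (Fin 2) (UnitaryGroup.LocalRing L v)).det w' =
      (((a.1.val.val : Matrix (Fin 2) (Fin 2) (UnitaryGroup.LocalRing L v)).map (fun x => x w')).det)⁻¹ := by
    have hmul : ((a.1.val⁻¹).val : Matrix (Fin 2) (Fin 2) (UnitaryGroup.LocalRing L v)).det *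
        (a.1.val.val : Matrix (Fin 2) (Fin 2) (UnitaryGroup.LocalRing L v)).det = 1 := by
      rw [← Matrix.det_mul, ← Units.val_mul, inv_mul_cancel, Units.val_one, Matrix.det_one]
    have hw := congrArg (fun f : UnitaryGroup.LocalRing L v => f w') hmul
    simp only [Pi.mul_apply, Pi.one_apply] at hw
    rw [det_map_apply_eq]
    exact eq_inv_of_mul_eq_one_left hw
  unfold finTauArg
  rw [Pi.mul_apply, Pi.neg_apply, hdet]

/-- **`σ(t_{w̄}) = −χ_w · u_w⁻²`** at a split place (★ `galAdicCompletionMap_eval_finCharpolyTwo_galInv`, `galAdicCompletionMap_det_galInv`).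
[cite: Rogawski1990, §4.9 p. 55; Lemma 4.13.1 p. 64] -/
theorem galAdicCompletionMap_finTauArg_galInv :
    galAdicCompletionMap (L := L) (IsCMField.complexConj L) (smul_inv_smul (IsCMField.complexConj L) w.1)
        (finTauArg L v a (UnitaryGroup.PlacesOver.galInv (IsCMField.complexConj L) w)) =
      -(((finCharpolyTwo L v a).eval (finGammaTwo L v a)) w) * (finGammaTwo L v a w ^ 2)⁻¹ := by
  have hd : (((a.1.val.val : Matrix (Fin 2) (Fin 2) (UnitaryGroup.LocalRing L v)).map (fun x => x w)).det) ≠ 0 :=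
    (isUnit_det_fst_map_apply L v a w).ne_zero
  rw [finTauArg_apply, map_mul, map_neg, map_inv₀, galAdicCompletionMap_eval_finCharpolyTwo_galInv, galAdicCompletionMap_det_galInv, inv_inv]
  field_simp

/-! ## §2 The guard `μᶜ = μ⁻¹` read at the two places over a split `v` -/

variable (μ : HeckeCharacter L)

/-- **`μ_{w̄}(z) = μ_w(σ z)⁻¹`** under conjugate self-duality `μ ∘ c = μ⁻¹` (★ `HeckeCharacter.localComponent_galConj_apply` with `c • w̄ = w`).
[cite: TateThesis1967, §4.3] [cite: CasselsFrohlichANT1967, Ch. VII §1.1] -/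
theorem localComponent_galInv_eq_inv_of_galConj_eq_inv (hdual : HeckeCharacter.galConj (IsCMField.complexConj L) μ = μ⁻¹)
    (z : ((UnitaryGroup.PlacesOver.galInv (IsCMField.complexConj L) w).1.adicCompletion L)ˣ) :
    μ.localComponent (UnitaryGroup.PlacesOver.galInv (IsCMField.complexConj L) w).1 z =
      (μ.localComponent w.1
        (Units.map (galAdicCompletionMap (L := L) (IsCMField.complexConj L) (smul_inv_smul (IsCMField.complexConj L) w.1) :
            (UnitaryGroup.PlacesOver.galInv (IsCMField.complexConj L) w).1.adicCompletion L →* w.1.adicCompletion L) z))⁻¹ := by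
  have h := HeckeCharacter.localComponent_galConj_apply (IsCMField.complexConj L) μ (smul_inv_smul (IsCMField.complexConj L) w.1) z
  rw [hdual] at h
  -- `(μ⁻¹)_{w̄}(z) = (μ_{w̄}(z))⁻¹`
  have hinv : (μ⁻¹).localComponent (UnitaryGroup.PlacesOver.galInv (IsCMField.complexConj L) w).1 z =
      (μ.localComponent (UnitaryGroup.PlacesOver.galInv (IsCMField.complexConj L) w).1 z)⁻¹ := rfl
  rw [hinv] at h
  exact inv_injective (by rw [inv_inv]; exact h)

/-- **`μ_v(x) = μ_w(x_w) · μ_w(σ x_{w̄})⁻¹`** at a split place under the guard, for a unit `x ∈ E_v` (★ `finHeckeValue_eq_prod_pair_of_split`).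
[cite: Rogawski1990, §4.9 p. 55] [cite: TateThesis1967, §4.3] -/
theorem finHeckeValue_eq_mul_inv_of_split (hw : IsCMField.complexConj L • w.1 ≠ w.1)
    (hdual : HeckeCharacter.galConj (IsCMField.complexConj L) μ = μ⁻¹) {x : UnitaryGroup.LocalRing L v} (hx : IsUnit x) :
    finHeckeValue L v μ x =
      ((μ.localComponent w.1 (MulEquiv.piUnits hx.unit w) : ℂˣ) : ℂ) *
        (((μ.localComponent w.1
            (Units.map (galAdicCompletionMap (L := L) (IsCMField.complexConj L) (smul_inv_smul (IsCMField.complexConj L) w.1) :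
                (UnitaryGroup.PlacesOver.galInv (IsCMField.complexConj L) w).1.adicCompletion L →* w.1.adicCompletion L)
              (MulEquiv.piUnits hx.unit (UnitaryGroup.PlacesOver.galInv (IsCMField.complexConj L) w))) : ℂˣ) : ℂ))⁻¹ := by
  rw [finHeckeValue_eq_prod_pair_of_split L v w hw μ hx, localComponent_galInv_eq_inv_of_galConj_eq_inv L v w μ hdual,
    Units.val_inv_eq_inv_val]

/-! ## §3 `τ_v(γ_H) = μ_w(det g_w)` on the `(G,H)`-regular locus -/

/-- **`τ_v(γ_H) = μ_w(det g_w)` AT A SPLIT PLACE** under the guard `μᶜ = μ⁻¹`, for `(G,H)`-regular `γ_H` (`χ_g(u) ∈ E_vˣ`): print's «at a split place `τ` is the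
character `μ_w ∘ det` of `M`» — `τ_v = μ_w(u_w² · (−χ_w u_w⁻²) · (−χ_w(det g_w)⁻¹)⁻¹) = μ_w(det g_w)`. [cite: Rogawski1990, §4.9 p. 55; Lemma 4.13.1 p. 64] -/
theorem finTau_eq_localComponent_det_of_split (hw : IsCMField.complexConj L • w.1 ≠ w.1)
    (hdual : HeckeCharacter.galConj (IsCMField.complexConj L) μ = μ⁻¹) (hu : IsUnit ((finCharpolyTwo L v a).eval (finGammaTwo L v a))) :
    finTau L v a μ = ((μ.localComponent w.1 (isUnit_det_fst_map_apply L v a w).unit : ℂˣ) : ℂ) := by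
  have hγ : IsUnit (finGammaTwo L v a) := isUnit_finGammaTwo L v a
  have ht : IsUnit (finTauArg L v a) := isUnit_finTauArg_of_isUnit L v a hu
  have hχ : ((finCharpolyTwo L v a).eval (finGammaTwo L v a)) w ≠ 0 := ((Pi.isUnit_iff.1 hu) w).ne_zero
  have hu0 : finGammaTwo L v a w ≠ 0 := ((Pi.isUnit_iff.1 hγ) w).ne_zero
  have hd0 : (((a.1.val.val : Matrix (Fin 2) (Fin 2) (UnitaryGroup.LocalRing L v)).map (fun x => x w)).det) ≠ 0 :=
    (isUnit_det_fst_map_apply L v a w).ne_zero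
  -- the unit identity `u_w · (σ u_{w̄})⁻¹ · (t_w · (σ t_{w̄})⁻¹)⁻¹ = det g_w` in `L_wˣ`
  have key : (isUnit_det_fst_map_apply L v a w).unit =
      MulEquiv.piUnits hγ.unit w *
          (Units.map (galAdicCompletionMap (L := L) (IsCMField.complexConj L) (smul_inv_smul (IsCMField.complexConj L) w.1) :
                (UnitaryGroup.PlacesOver.galInv (IsCMField.complexConj L) w).1.adicCompletion L →* w.1.adicCompletion L)
              (MulEquiv.piUnits hγ.unit (UnitaryGroup.PlacesOver.galInv (IsCMField.complexConj L) w)))⁻¹ *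
        (MulEquiv.piUnits ht.unit w *
            (Units.map (galAdicCompletionMap (L := L) (IsCMField.complexConj L) (smul_inv_smul (IsCMField.complexConj L) w.1) :
                  (UnitaryGroup.PlacesOver.galInv (IsCMField.complexConj L) w).1.adicCompletion L →* w.1.adicCompletion L)
                (MulEquiv.piUnits ht.unit (UnitaryGroup.PlacesOver.galInv (IsCMField.complexConj L) w)))⁻¹)⁻¹ := by
    refine Units.ext ?_
    simp only [Units.val_mul, Units.val_inv_eq_inv_val, Units.coe_map, MulEquiv.val_piUnits_apply, IsUnit.unit_spec, MonoidHom.coe_coe]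
    rw [galAdicCompletionMap_finGammaTwo_galInv, galAdicCompletionMap_finTauArg_galInv, finTauArg_apply]
    field_simp
  unfold finTau
  rw [finHeckeValue_eq_mul_inv_of_split L v w μ hw hdual hγ, finHeckeValue_eq_mul_inv_of_split L v w μ hw hdual ht, key]
  simp only [map_mul, map_inv, Units.val_mul, Units.val_inv_eq_inv_val]

/-- **`τ_v` IS A CLASS FUNCTION OF `det g_w`** on the `(G,H)`-regular locus at a split place (under the guard): two `(G,H)`-regular `γ_H, γ′_H ∈ H_v` with
`det g_w = det g′_w` have the same `τ_v`. [cite: Rogawski1990, §4.9 p. 55] -/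
theorem finTau_eq_finTau_of_det_eq_of_split (hw : IsCMField.complexConj L • w.1 ≠ w.1)
    (hdual : HeckeCharacter.galConj (IsCMField.complexConj L) μ = μ⁻¹)
    (a' : (UnitaryGroup.cmDatum L 2 (Matrix.of fun i j : Fin 2 => if i.val + j.val + 1 = 2 then (1 : L) else 0)).Local v ×
      (UnitaryGroup.cmDatum L 1 (Matrix.of fun i j : Fin 1 => if i.val + j.val + 1 = 1 then (1 : L) else 0)).Local v)
    (hu : IsUnit ((finCharpolyTwo L v a).eval (finGammaTwo L v a))) (hu' : IsUnit ((finCharpolyTwo L v a').eval (finGammaTwo L v a')))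
    (hdet : ((a.1.val.val : Matrix (Fin 2) (Fin 2) (UnitaryGroup.LocalRing L v)).map (fun x => x w)).det =
      ((a'.1.val.val : Matrix (Fin 2) (Fin 2) (UnitaryGroup.LocalRing L v)).map (fun x => x w)).det) :
    finTau L v a μ = finTau L v a' μ := by
  rw [finTau_eq_localComponent_det_of_split L v a w μ hw hdual hu, finTau_eq_localComponent_det_of_split L v a' w μ hw hdual hu']
  have hE : (isUnit_det_fst_map_apply L v a w).unit = (isUnit_det_fst_map_apply L v a' w).unit :=
    Units.ext (by rw [IsUnit.unit_spec, IsUnit.unit_spec, hdet])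
  rw [hE]

variable (H' : Matrix (Fin 3) (Fin 3) L)

open scoped Classical in
/-- **`Δ‴_v(γ_H, γ′) = μ_w(det g_w) · D_{G∕H,v}(γ_H)`** at a split place under the guard, for a matching pair with `γ_H` `(G,H)`-regular (`κ_v = +1`,
★ `finExplicitDelta_eq_tau_mul_weyl_of_split`). [cite: Rogawski1990, §14.6 p. 242; §4.9 p. 55; Lemma 4.13.1 p. 64] -/
theorem finExplicitDelta_eq_localComponent_det_mul_weyl_of_split (hw : IsCMField.complexConj L • w.1 ≠ w.1)
    (hdual : HeckeCharacter.galConj (IsCMField.complexConj L) μ = μ⁻¹) {b : (UnitaryGroup.cmDatum L 3 H').Local v} (h : IsLocalNormPair L H' v a b)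
    (hu : IsUnit ((finCharpolyTwo L v a).eval (finGammaTwo L v a))) :
    finExplicitDelta L v H' a μ b =
      ((μ.localComponent w.1 (isUnit_det_fst_map_apply L v a w).unit : ℂˣ) : ℂ) * ((finWeylRatio L v a : ℝ) : ℂ) := by
  rw [finExplicitDelta_eq_tau_mul_weyl_of_split L v a w H' hw μ h hu, finTau_eq_localComponent_det_of_split L v a w μ hw hdual hu]

end Literature.NumberTheory.Rogawski1990

end
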